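import Summits.Ventures.YMGap.Thresholds.ConnectedThreePointTools
import HarnessLib

/-!
# Venture YMGap — groundwork for C-DIFF3: the connected FOUR-point function (fourth cumulant) in moments, its symmetry,
# and its two split shapes (`W` isolated; `{X,Y}` against `{Z,W}`)

HONEST FRAMING: venture file of the cell `pub-ymgap` (QuantumFields programme), seat ds-1 (gen 10).  Pure probability
bookkeeping (bounded observables under a probability measure), no lattice number, nothing about the continuum or the Clay problem.
It is the algebra layer of the successor object «C⁴ / C^∞ in the coupling» (memo HOME/ds/ds1g10/NEXT-CDIFF3.md): the derivative
of the connected three-point function `u₃(X; Y; Z) = Cov(XY, Z) − E[X] Cov(Y, Z) − E[Y] Cov(X, Z)` along a one-parameter tilt with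
source `W` is the connected four-point function, which we therefore DEFINE in «derivative form»
`u₄(X; Y; Z; W) = u₃(XY; Z; W) − Cov(X, W) Cov(Y, Z) − E[X] u₃(Y; Z; W) − Cov(Y, W) Cov(X, Z) − E[Y] u₃(X; Z; W)` and prove:
* `fourPoint_eq_moments` — the 15-term moment expansion (the symmetric Ursell function `u₄`);
* `fourPoint_swap_yz`, `fourPoint_swap_zw` — symmetry under transpositions (hence under all permutations);
* `abs_fourPoint_le_isolated` — the split with `W` isolated: `|u₄| ≤` a sum of seven `|Cov(·, W)|` with bounded weights;
* `abs_fourPoint_le_pair` — the split `{X, Y} | {Z, W}`: `|u₄| ≤` a sum of cross-covariances `|Cov(A, B)|`, `A` a product of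
  `X, Y`, `B` a product of `Z, W`.
With g10's explicit clustering (`su2_abs_cov_le_of_sep`) each split turns into `C e^{−κ(m−2)}`; the seven bipartitions of four
slots and the single-linkage bound «largest bipartition gap ≥ (a₁ + a₂ + a₃)/9» then give the tree decay of `u₄` (successor work).

References (mechanism only): B. Simon, *The Statistical Mechanics of Lattice Gases* I (1993), §II.12 (Ursell functions);
M. Duneau, D. Iagolnitzer, B. Souillard, CMP 31 (1973) 191.
-/

noncomputable section

open MeasureTheory ProbabilityTheory Function Finset Filter Topology Real Set

namespace Summit.Ventures.YMGap.CouplingResponse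

section FourPoint

/-- Products of bounded functions are bounded. [folklore] -/
theorem abs_mul_le_mul_of_abs_le {Ω : Type*} {X Y : Ω → ℝ} {A B : ℝ} (hA : ∀ ω, |X ω| ≤ A) (hB : ∀ ω, |Y ω| ≤ B) :
    ∀ ω, |X ω * Y ω| ≤ A * B := fun ω => by
  rw [abs_mul]; exact mul_le_mul (hA ω) (hB ω) (abs_nonneg _) ((abs_nonneg _).trans (hA ω))

variable {Ω : Type*} [MeasurableSpace Ω] {μ : Measure Ω} [IsProbabilityMeasure μ] {X Y Z W : Ω → ℝ} {A B C D : ℝ}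

/-- Local shorthand: the connected three-point function `u₃(X; Y; Z)` under `μ`. -/
local notation3 (prettyPrint := false) "U₃[" X ";" Y ";" Z "]" =>
  cov[fun ω => X ω * Y ω, Z; μ] - (∫ ω, X ω ∂μ) * cov[Y, Z; μ] - (∫ ω, Y ω ∂μ) * cov[X, Z; μ]

/-- Local shorthand: the connected four-point function in derivative form `u₄(X; Y; Z; W)` under `μ`. -/
local notation3 (prettyPrint := false) "U₄[" X ";" Y ";" Z ";" W "]" =>
  (cov[fun ω => (X ω * Y ω) * Z ω, W; μ] - (∫ ω, X ω * Y ω ∂μ) * cov[Z, W; μ] - (∫ ω, Z ω ∂μ) * cov[fun ω => X ω * Y ω, W; μ])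
  - cov[X, W; μ] * cov[Y, Z; μ] - (∫ ω, X ω ∂μ) * U₃[Y ; Z ; W]
  - cov[Y, W; μ] * cov[X, Z; μ] - (∫ ω, Y ω ∂μ) * U₃[X ; Z ; W]


/-- **The connected four-point function in moments** (15 terms): for bounded measurable `X, Y, Z, W` under a probability measure,
`u₄(X;Y;Z;W) = m(XYZW) − Σ m(abc)m(d) − Σ m(ab)m(cd) + 2 Σ m(ab)m(c)m(d) − 6 m(X)m(Y)m(Z)m(W)`. [folklore] -/
theorem fourPoint_eq_moments (hX : Measurable X) (hY : Measurable Y) (hZ : Measurable Z) (hW : Measurable W)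
    (hA : ∀ ω, |X ω| ≤ A) (hB : ∀ ω, |Y ω| ≤ B) (hC : ∀ ω, |Z ω| ≤ C) (hD : ∀ ω, |W ω| ≤ D) :
    U₄[X ; Y ; Z ; W] =
      (∫ ω, X ω * Y ω * Z ω * W ω ∂μ)
      - (∫ ω, X ω * Y ω * Z ω ∂μ) * (∫ ω, W ω ∂μ) - (∫ ω, X ω * Y ω * W ω ∂μ) * (∫ ω, Z ω ∂μ)
      - (∫ ω, X ω * Z ω * W ω ∂μ) * (∫ ω, Y ω ∂μ) - (∫ ω, Y ω * Z ω * W ω ∂μ) * (∫ ω, X ω ∂μ)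
      - (∫ ω, X ω * Y ω ∂μ) * (∫ ω, Z ω * W ω ∂μ) - (∫ ω, X ω * Z ω ∂μ) * (∫ ω, Y ω * W ω ∂μ)
      - (∫ ω, X ω * W ω ∂μ) * (∫ ω, Y ω * Z ω ∂μ)
      + 2 * ((∫ ω, X ω * Y ω ∂μ) * (∫ ω, Z ω ∂μ) * (∫ ω, W ω ∂μ) + (∫ ω, X ω * Z ω ∂μ) * (∫ ω, Y ω ∂μ) * (∫ ω, W ω ∂μ)
        + (∫ ω, X ω * W ω ∂μ) * (∫ ω, Y ω ∂μ) * (∫ ω, Z ω ∂μ) + (∫ ω, Y ω * Z ω ∂μ) * (∫ ω, X ω ∂μ) * (∫ ω, W ω ∂μ)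
        + (∫ ω, Y ω * W ω ∂μ) * (∫ ω, X ω ∂μ) * (∫ ω, Z ω ∂μ) + (∫ ω, Z ω * W ω ∂μ) * (∫ ω, X ω ∂μ) * (∫ ω, Y ω ∂μ))
      - 6 * (∫ ω, X ω ∂μ) * (∫ ω, Y ω ∂μ) * (∫ ω, Z ω ∂μ) * (∫ ω, W ω ∂μ) := by
  have hXY := abs_mul_le_mul_of_abs_le hA hB
  have hXYm : Measurable fun ω => X ω * Y ω := hX.mul hY
  have hXYZ : ∀ ω, |X ω * Y ω * Z ω| ≤ A * B * C := abs_mul_le_mul_of_abs_le (X := fun ω => X ω * Y ω) hXY hC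
  have hXYZm : Measurable fun ω => X ω * Y ω * Z ω := hXYm.mul hZ
  have hXZ := abs_mul_le_mul_of_abs_le hA hC
  have hYZ := abs_mul_le_mul_of_abs_le hB hC
  rw [covariance_eq_sub_of_abs_le (X := fun ω => X ω * Y ω * Z ω) hXYZm hW hXYZ hD,
    covariance_eq_sub_of_abs_le hZ hW hC hD,
    covariance_eq_sub_of_abs_le (X := fun ω => X ω * Y ω) hXYm hW hXY hD,
    covariance_eq_sub_of_abs_le hX hW hA hD, covariance_eq_sub_of_abs_le hY hZ hB hC,
    covariance_eq_sub_of_abs_le (X := fun ω => Y ω * Z ω) (hY.mul hZ) hW hYZ hD,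
    covariance_eq_sub_of_abs_le hY hW hB hD, covariance_eq_sub_of_abs_le hX hZ hA hC,
    covariance_eq_sub_of_abs_le (X := fun ω => X ω * Z ω) (hX.mul hZ) hW hXZ hD]
  ring

/-- **Symmetry `X ↔ Y`** of the connected four-point function. [folklore] -/
theorem fourPoint_swap_xy (hX : Measurable X) (hY : Measurable Y) (hZ : Measurable Z) (hW : Measurable W)
    (hA : ∀ ω, |X ω| ≤ A) (hB : ∀ ω, |Y ω| ≤ B) (hC : ∀ ω, |Z ω| ≤ C) (hD : ∀ ω, |W ω| ≤ D) :
    U₄[X ; Y ; Z ; W] = U₄[Y ; X ; Z ; W] := by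
  rw [fourPoint_eq_moments hX hY hZ hW hA hB hC hD, fourPoint_eq_moments hY hX hZ hW hB hA hC hD]
  have e1 : (fun ω => Y ω * X ω * Z ω * W ω) = fun ω => X ω * Y ω * Z ω * W ω := by funext ω; ring
  have e2 : (fun ω => Y ω * X ω * Z ω) = fun ω => X ω * Y ω * Z ω := by funext ω; ring
  have e3 : (fun ω => Y ω * X ω * W ω) = fun ω => X ω * Y ω * W ω := by funext ω; ring
  have e4 : (fun ω => Y ω * X ω) = fun ω => X ω * Y ω := by funext ω; ring
  rw [e1, e2, e3, e4]
  ring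

/-- **Symmetry `Y ↔ Z`** of the connected four-point function. [folklore] -/
theorem fourPoint_swap_yz (hX : Measurable X) (hY : Measurable Y) (hZ : Measurable Z) (hW : Measurable W)
    (hA : ∀ ω, |X ω| ≤ A) (hB : ∀ ω, |Y ω| ≤ B) (hC : ∀ ω, |Z ω| ≤ C) (hD : ∀ ω, |W ω| ≤ D) :
    U₄[X ; Y ; Z ; W] = U₄[X ; Z ; Y ; W] := by
  rw [fourPoint_eq_moments hX hY hZ hW hA hB hC hD, fourPoint_eq_moments hX hZ hY hW hA hC hB hD]
  have e1 : (fun ω => X ω * Z ω * Y ω * W ω) = fun ω => X ω * Y ω * Z ω * W ω := by funext ω; ring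
  have e2 : (fun ω => X ω * Z ω * Y ω) = fun ω => X ω * Y ω * Z ω := by funext ω; ring
  have e3 : (fun ω => Z ω * Y ω * W ω) = fun ω => Y ω * Z ω * W ω := by funext ω; ring
  have e4 : (fun ω => Z ω * Y ω) = fun ω => Y ω * Z ω := by funext ω; ring
  rw [e1, e2, e3, e4]
  ring

/-- **Symmetry `Z ↔ W`** of the connected four-point function (with `X ↔ Y` and `Y ↔ Z` this generates all of `S₄`). [folklore] -/
theorem fourPoint_swap_zw (hX : Measurable X) (hY : Measurable Y) (hZ : Measurable Z) (hW : Measurable W)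
    (hA : ∀ ω, |X ω| ≤ A) (hB : ∀ ω, |Y ω| ≤ B) (hC : ∀ ω, |Z ω| ≤ C) (hD : ∀ ω, |W ω| ≤ D) :
    U₄[X ; Y ; Z ; W] = U₄[X ; Y ; W ; Z] := by
  rw [fourPoint_eq_moments hX hY hZ hW hA hB hC hD, fourPoint_eq_moments hX hY hW hZ hA hB hD hC]
  have e1 : (fun ω => X ω * Y ω * W ω * Z ω) = fun ω => X ω * Y ω * Z ω * W ω := by funext ω; ring
  have e2 : (fun ω => X ω * W ω * Z ω) = fun ω => X ω * Z ω * W ω := by funext ω; ring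
  have e3 : (fun ω => Y ω * W ω * Z ω) = fun ω => Y ω * Z ω * W ω := by funext ω; ring
  have e4 : (fun ω => W ω * Z ω) = fun ω => Z ω * W ω := by funext ω; ring
  rw [e1, e2, e3, e4]
  ring

/-- **The pair split `{X, Y} | {Z, W}` in cross form**: `u₄(X;Y;Z;W)` equals
`u₃(Z; W; XY) − Cov(X,W)Cov(Y,Z) − E[X] u₃(Z; W; Y) − Cov(Y,W)Cov(X,Z) − E[Y] u₃(Z; W; X)` — every term carries a covariance
between a product of `{X, Y}` and a product of `{Z, W}` (the three `u₃` are expanded with the `{Z, W}`-product first), so that a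
clustering bound across the split bounds `|u₄|`. [folklore] -/
theorem fourPoint_pair_form (hX : Measurable X) (hY : Measurable Y) (hZ : Measurable Z) (hW : Measurable W)
    (hA : ∀ ω, |X ω| ≤ A) (hB : ∀ ω, |Y ω| ≤ B) (hC : ∀ ω, |Z ω| ≤ C) (hD : ∀ ω, |W ω| ≤ D) :
    U₄[X ; Y ; Z ; W] =
      (cov[fun ω => Z ω * W ω, fun ω => X ω * Y ω; μ] - (∫ ω, Z ω ∂μ) * cov[W, fun ω => X ω * Y ω; μ]
          - (∫ ω, W ω ∂μ) * cov[Z, fun ω => X ω * Y ω; μ])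
      - cov[X, W; μ] * cov[Y, Z; μ]
      - (∫ ω, X ω ∂μ) * (cov[fun ω => Z ω * W ω, Y; μ] - (∫ ω, Z ω ∂μ) * cov[W, Y; μ] - (∫ ω, W ω ∂μ) * cov[Z, Y; μ])
      - cov[Y, W; μ] * cov[X, Z; μ]
      - (∫ ω, Y ω ∂μ) * (cov[fun ω => Z ω * W ω, X; μ] - (∫ ω, Z ω ∂μ) * cov[W, X; μ] - (∫ ω, W ω ∂μ) * cov[Z, X; μ]) := by
  have hXY := abs_mul_le_mul_of_abs_le hA hB
  have hXYm : Measurable fun ω => X ω * Y ω := hX.mul hY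
  have hZW := abs_mul_le_mul_of_abs_le hC hD
  have hZWm : Measurable fun ω => Z ω * W ω := hZ.mul hW
  rw [fourPoint_eq_moments hX hY hZ hW hA hB hC hD,
    covariance_eq_sub_of_abs_le (X := fun ω => Z ω * W ω) (Y := fun ω => X ω * Y ω) hZWm hXYm hZW hXY,
    covariance_eq_sub_of_abs_le (Y := fun ω => X ω * Y ω) hW hXYm hD hXY,
    covariance_eq_sub_of_abs_le (Y := fun ω => X ω * Y ω) hZ hXYm hC hXY,
    covariance_eq_sub_of_abs_le hX hW hA hD, covariance_eq_sub_of_abs_le hY hZ hB hC,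
    covariance_eq_sub_of_abs_le (X := fun ω => Z ω * W ω) hZWm hY hZW hB,
    covariance_eq_sub_of_abs_le hW hY hD hB, covariance_eq_sub_of_abs_le hZ hY hC hB,
    covariance_eq_sub_of_abs_le hY hW hB hD, covariance_eq_sub_of_abs_le hX hZ hA hC,
    covariance_eq_sub_of_abs_le (X := fun ω => Z ω * W ω) hZWm hX hZW hA,
    covariance_eq_sub_of_abs_le hW hX hD hA, covariance_eq_sub_of_abs_le hZ hX hC hA]
  have e1 : (fun ω => Z ω * W ω * (X ω * Y ω)) = fun ω => X ω * Y ω * Z ω * W ω := by funext ω; ring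
  have e2 : (fun ω => W ω * (X ω * Y ω)) = fun ω => X ω * Y ω * W ω := by funext ω; ring
  have e3 : (fun ω => Z ω * (X ω * Y ω)) = fun ω => X ω * Y ω * Z ω := by funext ω; ring
  have e4 : (fun ω => Z ω * W ω * Y ω) = fun ω => Y ω * Z ω * W ω := by funext ω; ring
  have e5 : (fun ω => W ω * Y ω) = fun ω => Y ω * W ω := by funext ω; ring
  have e6 : (fun ω => Z ω * Y ω) = fun ω => Y ω * Z ω := by funext ω; ring
  have e7 : (fun ω => Z ω * W ω * X ω) = fun ω => X ω * Z ω * W ω := by funext ω; ring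
  have e8 : (fun ω => W ω * X ω) = fun ω => X ω * W ω := by funext ω; ring
  have e9 : (fun ω => Z ω * X ω) = fun ω => X ω * Z ω := by funext ω; ring
  rw [e1, e2, e3, e4, e5, e6, e7, e8, e9]
  ring

end FourPoint

end Summit.Ventures.YMGap.CouplingResponse

end
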